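import Summits.ValiantsHypothesis.ValiantsHypothesis.Theorems.GrenetZeonPolySizeQPAlgebraLocalDecomposition
import HarnessLib

/-!
# Gorenstein normal form of `(m, s)`-representations (census of stmt-ValiantsHypothesis-8063)

Helper file for the crux `AbelianizationQP` (stmt-8063, line `zeon-window`) and the piece
`PolySizeQPAlgebra` (stmt-8064) of route `GrenetZeon`.  The informal statement of the crux speaks
the language of APOLAR ALGEBRAS (zeons = apolar algebra of `y₁ ⋯ yₙ`; Landsberg–Ressayre = apolar
algebra of `det_n`), i.e. of local GORENSTEIN coefficient algebras read through a socle
functional.  This file proves that this is no loss of generality for the two-parameter model: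

* `HasAlgDetRepr.exists_nondegenerate` (Literature `AlgDetRepr.lean`): WLOG the trace form
  `(x, y) ↦ λ(x y)` is nondegenerate (`(R, λ)` a commutative Frobenius pair);
* `nondegenerate_single` (here): nondegeneracy passes to every factor of a product `∏ᵢ Rᵢ` read
  through `λᵢ = λ ∘ ιᵢ`;
* `exists_local_frobenius_decomposition` (here): hence, over an algebraically closed field, every
  `(m, s)`-representation of `f` is a sum `f = Σ_{i<t} fᵢ` (`t ≤ s`, `Σ dim Rᵢ ≤ s`) of
  representations of the same matrix size over LOCAL FROBENIUS pairs `(Rᵢ, λᵢ)`;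
* `apply_ne_zero_of_socle`, `socle_smul_comm` (here): in a local Frobenius pair the functional
  detects every nonzero socle element and the socle is one-dimensional (any two socle elements are
  proportional through `λ`) — `Rᵢ` is a local Artinian GORENSTEIN algebra and `λᵢ` a socle
  generator of its dual, i.e. (Macaulay) `Rᵢ` is the apolar algebra of one polynomial and `λᵢ`
  the evaluation at it, up to a unit.

So the witness algebras of the crux may be assumed to be sums of apolar algebras of single
(inhomogeneous) polynomials `Fᵢ` with `Σ dim ≤ s`, exactly the shape of the two known instances.

No stub is closed; `VP ≠ VNP` is not touched.

## References

* P. Hrubeš, A. Yehudayoff, *Arithmetic complexity in ring extensions*, Theory of Computing 7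
  (2011), §2. [cite: HrubesYehudayoff2011, §2]
* F. S. Macaulay, *The algebraic theory of modular systems* (1916), §§60–72 (inverse systems;
  local Artinian Gorenstein = apolar algebra of one polynomial) — background only, not used.
-/

set_option linter.dupNamespace false

noncomputable section

namespace Summit.ValiantsHypothesis.ValiantsHypothesis.Theorems.GrenetZeonPolySizeQPAlgebra

open MvPolynomial Matrix
open Literature.Computability.AlgebraicComplexity

universe u v w

section Frobenius

variable {k : Type u} [Field k] {σ : Type v}

/-- **Nondegeneracy passes to the factors of a product.** If `λ` is nondegenerate on `∏ᵢ Rᵢ`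
(`λ(x r) = 0` for all `x` forces `r = 0`), then `λᵢ = λ ∘ ιᵢ` is nondegenerate on `Rᵢ`
(test against `x = ιᵢ(xᵢ)`: `ιᵢ(xᵢ) · ιᵢ(rᵢ) = ιᵢ(xᵢ rᵢ)`, and `x · ιᵢ(rᵢ) = ιᵢ(xᵢ rᵢ)`).
[folklore] -/
theorem nondegenerate_single {ι : Type w} [Fintype ι] [DecidableEq ι] {R : ι → Type u}
    [∀ i, CommRing (R i)] [∀ i, Algebra k (R i)] (l : (∀ i, R i) →ₗ[k] k)
    (hl : ∀ r : ∀ i, R i, (∀ x, l (x * r) = 0) → r = 0) (i : ι) :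
    ∀ r : R i, (∀ x, (l ∘ₗ LinearMap.single k R i) (x * r) = 0) → r = 0 := by
  intro r hr
  have h := hl (Pi.single i r) fun x => by
    have hx : x * Pi.single i r = Pi.single i (x i * r) := by
      ext j
      by_cases hj : j = i
      · subst hj; simp
      · simp [Pi.single_eq_of_ne hj]
    rw [hx]
    exact hr (x i)
  simpa using congrFun h i

/-- Transport of nondegeneracy along an algebra isomorphism `e : R ≃ₐ R'`: `λ ∘ e⁻¹` is
nondegenerate on `R'` if `λ` is on `R`. [folklore] -/
theorem nondegenerate_transport {R R' : Type*} [CommRing R] [CommRing R'] [Algebra k R]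
    [Algebra k R'] (e : R ≃ₐ[k] R') (l : R →ₗ[k] k)
    (hl : ∀ r : R, (∀ x, l (x * r) = 0) → r = 0) :
    ∀ r : R', (∀ x, (l ∘ₗ e.symm.toLinearMap) (x * r) = 0) → r = 0 := by
  intro r hr
  have h := hl (e.symm r) fun x => by
    have := hr (e x)
    rwa [LinearMap.comp_apply, AlgEquiv.toLinearMap_apply, map_mul, e.symm_apply_apply] at this
  simpa using congrArg e h

/-- **Local Frobenius decomposition.** Over an algebraically closed field, if `f` has an
`(m, s)`-representation then `f = Σ_{i<t} fᵢ` with `t ≤ s` and `Σᵢ dim Rᵢ ≤ s`, where each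
`fᵢ = λᵢ(det Aᵢ)` for an affine `m × m` matrix over a LOCAL algebra `Rᵢ` (character `φᵢ`,
`(ker φᵢ)^s = 0`) read through a NONDEGENERATE functional `λᵢ` (`(Rᵢ, λᵢ)` a local Frobenius
pair).  First make `λ` nondegenerate (`HasAlgDetRepr.exists_nondegenerate`), then split along
`R ≅ ∏_𝔪 R ⧸ 𝔪^s` (`nondegenerate_single`). [cite: HrubesYehudayoff2011, §2] -/
theorem exists_local_frobenius_decomposition [IsAlgClosed k] {f : MvPolynomial σ k} {m s : ℕ}
    (h : HasAlgDetRepr f m s) :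
    ∃ (t : ℕ) (F : Fin t → MvPolynomial σ k) (dim : Fin t → ℕ),
      t ≤ s ∧ ∑ i, dim i ≤ s ∧ f = ∑ i, F i ∧
        ∀ i, ∃ (Rᵢ : Type u) (_ : CommRing Rᵢ) (_ : Algebra k Rᵢ) (_ : Module.Finite k Rᵢ)
          (φ : Rᵢ →ₐ[k] k), RingHom.ker (φ : Rᵢ →+* k) ^ s = ⊥ ∧ Module.finrank k Rᵢ = dim i ∧
            ∃ (lᵢ : Rᵢ →ₗ[k] k) (Aᵢ : Matrix (Fin m) (Fin m) (MvPolynomial σ Rᵢ)),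
              (∀ a b, (Aᵢ a b).totalDegree ≤ 1) ∧
                (∀ d : σ →₀ ℕ, lᵢ (coeff d Aᵢ.det) = coeff d (F i)) ∧
                  ∀ r : Rᵢ, (∀ x, lᵢ (x * r) = 0) → r = 0 := by
  classical
  obtain ⟨R, _, _, _, hR, l, A, hA, hf, hl⟩ := h.exists_nondegenerate
  rcases Nat.eq_zero_or_pos s with hs0 | hs1
  · subst hs0
    haveI : Subsingleton R := Module.finrank_zero_iff.mp (Nat.le_zero.mp hR)
    refine ⟨0, Fin.elim0, Fin.elim0, le_rfl, by simp, ?_, fun i => i.elim0⟩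
    refine MvPolynomial.ext _ _ fun d => ?_
    rw [← hf d, Subsingleton.elim (coeff d A.det) 0, map_zero]
    simp
  have hν : (nilradical R) ^ s = ⊥ := by
    refine le_bot_iff.mp ?_
    calc (nilradical R) ^ s ≤ (nilradical R) ^ Module.finrank k R := Ideal.pow_le_pow_right hR
      _ = ⊥ := nilradical_pow_finrank_eq_bot (k := k)
  haveI : IsArtinianRing R := IsArtinianRing.of_finite k R
  let ι := MaximalSpectrum R
  haveI : Fintype ι := Fintype.ofFinite ι
  let Q : ι → Type u := fun I => R ⧸ I.asIdeal ^ s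
  let e₀ : R ≃ₐ[R] (∀ I : ι, Q I) :=
    (((AlgEquiv.quotientBot R R).symm.trans
      (Ideal.quotientEquivAlgOfEq R hν.symm)).trans (IsArtinianRing.quotNilradicalPowEquivPi R s))
  let e : R ≃ₐ[k] (∀ I : ι, Q I) := e₀.restrictScalars k
  obtain ⟨hA', hf'⟩ := repr_transport e l A hA hf
  have hl' := nondegenerate_transport e l hl
  set A' := (MvPolynomial.map (e : R →+* ∀ I : ι, Q I)).mapMatrix A with hA'def
  set l' := l ∘ₗ e.symm.toLinearMap with hl'def
  have hdec := eq_sum_of_repr_pi l' A' hf'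
  haveI hQfin : ∀ I : ι, Module.Finite k (Q I) := fun I =>
    Module.Finite.of_surjective (Ideal.Quotient.mkₐ k (I.asIdeal ^ s)).toLinearMap
      (Ideal.Quotient.mkₐ_surjective k _)
  have hsum : ∑ I : ι, Module.finrank k (Q I) ≤ s := by
    rw [← Module.finrank_pi_fintype k, ← e.toLinearEquiv.finrank_eq]
    exact hR
  have hAI : ∀ (I : ι) i j,
      (((MvPolynomial.map (Pi.evalRingHom Q I)).mapMatrix A') i j).totalDegree ≤ 1 :=
    fun I i j => by
      rw [RingHom.mapMatrix_apply, Matrix.map_apply]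
      exact (Finset.sup_mono (MvPolynomial.support_map_subset _ (A' i j))).trans (hA' i j)
  let t := Fintype.card ι
  let g : Fin t ≃ ι := (Fintype.equivFin ι).symm
  let F : ι → MvPolynomial σ k := fun I =>
    (AddMonoidAlgebra.map (l' ∘ₗ LinearMap.single k Q I).toAddMonoidHom
      ((MvPolynomial.map (Pi.evalRingHom Q I)).mapMatrix A').det : MvPolynomial σ k)
  refine ⟨t, fun i => F (g i), fun i => Module.finrank k (Q (g i)), ?_, ?_, ?_, fun i => ?_⟩
  · exact (card_maximalSpectrum_le_finrank (k := k)).trans hR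
  · calc ∑ i, Module.finrank k (Q (g i)) = ∑ I, Module.finrank k (Q I) :=
          Fintype.sum_equiv g _ _ fun _ => rfl
      _ ≤ s := hsum
  · rw [hdec]
    exact (Fintype.sum_equiv g _ _ fun _ => rfl).symm
  · haveI : (g i).asIdeal.IsMaximal := (g i).isMaximal
    obtain ⟨φ, hφ⟩ := exists_character_quotient_pow (k := k) (g i).asIdeal s hs1
    exact ⟨Q (g i), inferInstance, inferInstance, inferInstance, φ, hφ, rfl,
      l' ∘ₗ LinearMap.single k Q (g i), (MvPolynomial.map (Pi.evalRingHom Q (g i))).mapMatrix A',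
      hAI (g i), fun d => rfl, nondegenerate_single l' hl' (g i)⟩

/-- **In a local Frobenius pair the functional detects the socle.** Let `φ : R → k` be a
character and `λ` nondegenerate.  If `r ≠ 0` is annihilated by `ker φ` (a socle element), then
`λ r ≠ 0`: indeed `x · r = φ(x) r` for every `x`, so `λ(x r) = φ(x) λ(r)`. [folklore] -/
theorem apply_ne_zero_of_socle {R : Type*} [CommRing R] [Algebra k R] (φ : R →ₐ[k] k)
    (l : R →ₗ[k] k) (hl : ∀ r : R, (∀ x, l (x * r) = 0) → r = 0) {r : R}
    (hr : ∀ x, φ x = 0 → x * r = 0) (hr0 : r ≠ 0) : l r ≠ 0 := by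
  intro h0
  apply hr0
  refine hl r fun x => ?_
  have hx : (x - algebraMap k R (φ x)) * r = 0 := hr _ (by simp)
  rw [sub_mul, sub_eq_zero] at hx
  rw [hx, Algebra.algebraMap_eq_smul_one, smul_mul_assoc, one_mul, map_smul, h0, smul_zero]

/-- **The socle of a local Frobenius pair is one-dimensional** (the algebra is GORENSTEIN): any
two socle elements `r, r'` are proportional, `λ(r') · r = λ(r) · r'` — the combination
`λ(r') r - λ(r) r'` is a socle element killed by `λ`, hence zero (`apply_ne_zero_of_socle`).
So `λ` restricted to the socle is an isomorphism onto `k`: the local factors of the normal form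
are apolar algebras of single polynomials read at their socle. [folklore] -/
theorem socle_smul_comm {R : Type*} [CommRing R] [Algebra k R] (φ : R →ₐ[k] k)
    (l : R →ₗ[k] k) (hl : ∀ r : R, (∀ x, l (x * r) = 0) → r = 0) {r r' : R}
    (hr : ∀ x, φ x = 0 → x * r = 0) (hr' : ∀ x, φ x = 0 → x * r' = 0) :
    l r' • r = l r • r' := by
  by_contra hne
  have hsoc : ∀ x, φ x = 0 → x * (l r' • r - l r • r') = 0 := fun x hx => by
    rw [mul_sub, mul_smul_comm, mul_smul_comm, hr x hx, hr' x hx, smul_zero, smul_zero, sub_zero]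
  have h := apply_ne_zero_of_socle φ l hl hsoc (sub_ne_zero.mpr hne)
  apply h
  rw [map_sub, map_smul, map_smul, smul_eq_mul, smul_eq_mul, mul_comm, sub_self]

/-- The top Loewy layer is socle: if `(ker φ)^ν = 0` then every element of `(ker φ)^(ν - 1)` is
annihilated by `ker φ`; so in a local Frobenius factor of depth exactly `ν` the functional `λ`
does not vanish on `(ker φ)^(ν - 1)` (`apply_ne_zero_of_socle`) — the DEEPEST layer of the witness
algebra is always read. [folklore] -/
theorem mul_eq_zero_of_mem_pow_pred {R : Type*} [CommRing R] [Algebra k R] (φ : R →ₐ[k] k)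
    {ν : ℕ} (hν1 : 1 ≤ ν) (hν : RingHom.ker (φ : R →+* k) ^ ν = ⊥) {r : R}
    (hr : r ∈ RingHom.ker (φ : R →+* k) ^ (ν - 1)) (x : R) (hx : φ x = 0) : x * r = 0 := by
  have hxm : x ∈ RingHom.ker (φ : R →+* k) := by rwa [RingHom.mem_ker]
  have h : x * r ∈ RingHom.ker (φ : R →+* k) ^ ν := by
    have := Ideal.mul_mem_mul hxm hr
    rwa [← pow_succ', Nat.sub_add_cancel hν1] at this
  rw [hν, Ideal.mem_bot] at h
  exact h

end Frobenius

end Summit.ValiantsHypothesis.ValiantsHypothesis.Theorems.GrenetZeonPolySizeQPAlgebra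

end
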